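import Mathlib
import Summits.NavierStokesRegularity.NavierStokesRegularity.Theorems.EulerZoomLiouvillePowerGaugeEulerLiouvilleSelfSimilarTopBadNodeTools
import Summits.NavierStokesRegularity.NavierStokesRegularity.Theorems.EulerZoomLiouvillePowerGaugeEulerLiouvilleSelfSimilarNodeCertificates
import Summits.NavierStokesRegularity.NavierStokesRegularity.Theorems.EulerZoomLiouvillePowerGaugeEulerLiouvilleSelfSimilarVorticityTransport
import HarnessLib.Audit

/-!
# Rung C1 of the crux `EulerZoomLiouville.PowerGaugeEulerLiouville`: a bad non-vortical node has thin
# backward-trapped sets, and the eigen-coordinate energy inequality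

Route №10 `EulerZoomLiouville` (NavierStokesRegularity), crux E = stmt-NavierStokesRegularity-19832,
tenure rung C1 (exactly self-similar members), registered residue `stub_selfSimilarExtremal`.
Fourth file of the NODAL-CONTINUUM line (lineage ns-typeII-p1, gen 7): two inputs of the exit analysis
at the top bad node (`…SelfSimilarTopBadNodeHyperbolic`) for a `C²` stationary self-similar Euler
profile `(U, P)` (CIV 2026 (3.3); `V = γ(y−c) + U`, `Ω = curl U`):

* `sum_coord_velocity_le` — for a symmetric `A` with orthonormal eigenbasis `b` and eigenvalues
  `a_i ≥ μ > 0` on an index set `I`: `Σ_{i∈I} 2⟪b i, ζ⟫⟪b i, −Aζ − E⟫ ≤ −μ Σ_{i∈I}⟪b i, ζ⟫² + |E|²/μ`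
  (the derivative of the `I`-part of `|ζ|²` along `ζ' = −Aζ − E`, absorbed termwise);
* `exists_thinRadius_of_badNode` — **at a stagnation point `z` with `curl U(z) = 0` and a unit `w` with
  `⟪DU(z)w, w⟫ ≥ 1` (`γ < ½`), the set of points whose backward trajectory stays in `B̄(z, δ₀)` has
  EMPTY INTERIOR for some `δ₀ > 0`**: the symmetric `DV(z)` has top eigenvalue `≥ 1 + γ`, which refutes
  the KILL alternative of the tree's node certificate (`certificate_of_curl_eq_zero`), so the THIN
  alternative holds and the cone lemma (`interior_backwardTrapped_eq_empty`) applies.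

WHAT THIS IS NOT: not NS, not E, not rung C1 — bookkeeping for classical profiles.
References: P. Constantin, M. Ignatova, V. Vicol, arXiv:2602.17570 (2026), §3.5 Thms 3.8–3.10
[ConstantinIgnatovaVicol2026Putative]; A. Katok, B. Hasselblatt, *Introduction to the Modern Theory of
Dynamical Systems* (1995), §6.2 [KatokHasselblatt1995].
-/

noncomputable section

-- flat `Theorems/<Route><Decl>…` files of one crux share the namespace of the crux (tree convention)
set_option linter.dupNamespace false

open Set Filter Topology Metric Function InnerProductSpace
open scoped RealInnerProductSpace NNReal

namespace Summit.NavierStokesRegularity.NavierStokesRegularity.Theorems.PowerGaugeEulerLiouville.NodalContinuum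

open Literature.Analysis Literature.Analysis.FluidPDE Literature.Analysis.ODE
open Summit.NavierStokesRegularity.NavierStokesRegularity.Theorems.PowerGaugeEulerLiouville.NodalFiniteness

variable {γ C : ℝ} {c : EuclideanSpace ℝ (Fin 3)}
  {U : EuclideanSpace ℝ (Fin 3) → EuclideanSpace ℝ (Fin 3)} {P : EuclideanSpace ℝ (Fin 3) → ℝ}

/-- An elementary absorption inequality: `−2ζE ≤ μζ² + E²/μ` (`μ > 0`). [folklore] -/
private theorem neg_two_mul_le_aux {μ : ℝ} (hμ : 0 < μ) (x e : ℝ) :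
    -(2 * (x * e)) ≤ μ * x ^ 2 + e ^ 2 / μ := by
  have h0 : 0 ≤ (μ * x + e) ^ 2 / μ := by positivity
  have e1 : (μ * x + e) ^ 2 / μ = μ * x ^ 2 + e ^ 2 / μ + 2 * (x * e) := by
    field_simp
    ring
  linarith

/-- **Termwise energy inequality in eigen-coordinates.**  For a symmetric `A` with orthonormal
eigenbasis `b`, eigenvalues `a_i ≥ μ > 0` on the index set `I`, and vectors `ζ, E`:
`Σ_{i∈I} 2⟪b i, ζ⟫⟪b i, −Aζ − E⟫ ≤ −μ Σ_{i∈I} ⟪b i, ζ⟫² + |E|²/μ` (the derivative of the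
`I`-component of `|ζ|²` along `ζ' = −Aζ − E`). [folklore] -/
theorem sum_coord_velocity_le {A : EuclideanSpace ℝ (Fin 3) →L[ℝ] EuclideanSpace ℝ (Fin 3)}
    (hA : (A : EuclideanSpace ℝ (Fin 3) →ₗ[ℝ] EuclideanSpace ℝ (Fin 3)).IsSymmetric)
    (b : OrthonormalBasis (Fin 3) ℝ (EuclideanSpace ℝ (Fin 3))) {a : Fin 3 → ℝ}
    (hb : ∀ i, A (b i) = a i • b i) {μ : ℝ} (hμ : 0 < μ) (I : Finset (Fin 3))
    (hI : ∀ i ∈ I, μ ≤ a i) (ζ E : EuclideanSpace ℝ (Fin 3)) :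
    ∑ i ∈ I, 2 * ⟪b i, ζ⟫ * ⟪b i, -(A ζ) - E⟫ ≤
      -μ * (∑ i ∈ I, ⟪b i, ζ⟫ ^ 2) + ‖E‖ ^ 2 / μ := by
  have hterm : ∀ i ∈ I, 2 * ⟪b i, ζ⟫ * ⟪b i, -(A ζ) - E⟫ ≤ -μ * ⟪b i, ζ⟫ ^ 2 + ⟪b i, E⟫ ^ 2 / μ := by
    intro i hi
    rw [inner_sub_right, inner_neg_right, inner_basis_apply_of_isSymmetric hA b hb ζ i]
    have h1 := neg_two_mul_le_aux hμ ⟪b i, ζ⟫ ⟪b i, E⟫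
    have h2 : μ * ⟪b i, ζ⟫ ^ 2 ≤ a i * ⟪b i, ζ⟫ ^ 2 := mul_le_mul_of_nonneg_right (hI i hi) (sq_nonneg _)
    have e : 2 * ⟪b i, ζ⟫ * (-(a i * ⟪b i, ζ⟫) - ⟪b i, E⟫) =
        -2 * (a i * ⟪b i, ζ⟫ ^ 2) - 2 * (⟪b i, ζ⟫ * ⟪b i, E⟫) := by ring
    rw [e]
    linarith
  have hsumE : ∑ i ∈ I, ⟪b i, E⟫ ^ 2 / μ ≤ ‖E‖ ^ 2 / μ := by
    rw [← Finset.sum_div]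
    exact div_le_div_of_nonneg_right (sum_sq_inner_filter_le b I E) hμ.le
  calc ∑ i ∈ I, 2 * ⟪b i, ζ⟫ * ⟪b i, -(A ζ) - E⟫
      ≤ ∑ i ∈ I, (-μ * ⟪b i, ζ⟫ ^ 2 + ⟪b i, E⟫ ^ 2 / μ) := Finset.sum_le_sum hterm
    _ = -μ * (∑ i ∈ I, ⟪b i, ζ⟫ ^ 2) + ∑ i ∈ I, ⟪b i, E⟫ ^ 2 / μ := by
        rw [Finset.sum_add_distrib, Finset.mul_sum]
    _ ≤ -μ * (∑ i ∈ I, ⟪b i, ζ⟫ ^ 2) + ‖E‖ ^ 2 / μ := by linarith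

/-- **A bad non-vortical node has thin backward-trapped sets** (`γ < ½`).  At a stagnation point `z`
with `curl U(z) = 0` and a unit `w` with `⟪DU(z)w, w⟫ ≥ 1`, the symmetric `DV(z)` has top eigenvalue
`≥ 1 + γ`, which refutes the KILL alternative of `certificate_of_curl_eq_zero`; the THIN alternative and
the cone lemma (`interior_backwardTrapped_eq_empty`) give `δ₀ > 0` such that the set of points whose
backward trajectory stays in `B̄(z, δ₀)` has empty interior.
[cite: ConstantinIgnatovaVicol2026Putative, §3.5 Thms 3.8–3.10] [cite: KatokHasselblatt1995, §6.2 (cone criterion)] -/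
theorem exists_thinRadius_of_badNode (h : IsSelfSimilarEulerProfile γ c U P) (hγ2 : γ < 1 / 2)
    {K : ℝ≥0} (hK : LipschitzWith K (selfSimilarTransport γ c U)) {z : EuclideanSpace ℝ (Fin 3)}
    (hΩz : curl U z = 0)
    (hbad : ∃ w : EuclideanSpace ℝ (Fin 3), ‖w‖ = 1 ∧ 1 ≤ ⟪fderiv ℝ U z w, w⟫) :
    ∃ δ₀ > 0, interior {x : EuclideanSpace ℝ (Fin 3) |
      ∀ t, 0 ≤ t → lipschitzFlow hK x (-t) ∈ closedBall z δ₀} = ∅ := by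
  classical
  set A : EuclideanSpace ℝ (Fin 3) →L[ℝ] EuclideanSpace ℝ (Fin 3) :=
    fderiv ℝ (selfSimilarTransport γ c U) z with hAdef
  have hUd := h.differentiable_velocity
  have hDV : A = γ • ContinuousLinearMap.id ℝ _ + fderiv ℝ U z := fderiv_transport_eq h z
  have hSU := isSymmetric_fderiv_of_curl_eq_zero (hUd z) hΩz
  have hA : (A : EuclideanSpace ℝ (Fin 3) →ₗ[ℝ] EuclideanSpace ℝ (Fin 3)).IsSymmetric := by
    rw [hDV]
    intro x y
    have hSxy := hSU x y
    simp only [ContinuousLinearMap.coe_coe] at hSxy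
    simp only [ContinuousLinearMap.coe_coe, add_apply,
      FunLike.coe_smul, Pi.smul_apply, ContinuousLinearMap.id_apply,
      inner_add_left, inner_add_right, real_inner_smul_left, real_inner_smul_right]
    rw [hSxy]
  rcases certificate_of_curl_eq_zero h hγ2 hΩz with
    ⟨B, cB, β', hcB, hβ', hBc, hBle⟩ | ⟨Q, η, θ, e, hη, hθ, he, hQ⟩
  · exfalso
    have hn : Module.finrank ℝ (EuclideanSpace ℝ (Fin 3)) = 3 := by simp
    set b := hA.eigenvectorBasis hn with hbdef
    set a : Fin 3 → ℝ := hA.eigenvalues hn with hadef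
    have hb : ∀ i, A (b i) = a i • b i := fun i => hA.apply_eigenvectorBasis hn i
    obtain ⟨w, hw1, hw⟩ := hbad
    have hAw : 1 + γ ≤ ⟪A w, w⟫ := by
      rw [hDV]
      simp only [add_apply, FunLike.coe_smul, Pi.smul_apply,
        ContinuousLinearMap.id_apply, inner_add_left, real_inner_smul_left,
        real_inner_self_eq_norm_sq, hw1]
      linarith
    obtain ⟨j, -, hj⟩ := Finset.exists_max_image Finset.univ a Finset.univ_nonempty
    have htop : ⟪A w, w⟫ ≤ a j := by
      rw [inner_apply_self_eq_sum_eigen hA b hb w]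
      calc ∑ i, a i * ⟪b i, w⟫ ^ 2 ≤ ∑ i, a j * ⟪b i, w⟫ ^ 2 :=
            Finset.sum_le_sum fun i _ => mul_le_mul_of_nonneg_right (hj i (Finset.mem_univ _))
              (sq_nonneg _)
        _ = a j * ‖w‖ ^ 2 := by rw [← Finset.mul_sum, b.sum_sq_inner_right]
        _ = a j := by rw [hw1]; ring
    have hcert := hBle (b j)
    have e1 : fderiv ℝ (selfSimilarTransport γ c U) z (b j) = a j • b j := hb j
    rw [e1] at hcert
    simp only [map_smul, FunLike.coe_smul, Pi.smul_apply, smul_eq_mul] at hcert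
    have hBpos : 0 < B (b j) (b j) := by
      have := hBc (b j)
      rw [b.orthonormal.1 j] at this
      linarith
    have h1 : a j * B (b j) (b j) ≤ β' * B (b j) (b j) := by linarith
    have h2 : a j ≤ β' := le_of_mul_le_mul_right h1 hBpos
    linarith
  · exact interior_backwardTrapped_eq_empty h hK z Q hη hθ hQ he

end Summit.NavierStokesRegularity.NavierStokesRegularity.Theorems.PowerGaugeEulerLiouville.NodalContinuum
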